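import Summits.NavierStokesRegularity.NavierStokesRegularity.Theorems.ExtremiserTransienceNearExtremalTransienceExtremiserLiouvilleConstantSpeedReversal
import HarnessLib

/-!
# Crux `ExtremiserTransience.NearExtremalTransience` (stmt-NavierStokesRegularity-21883), line `extremiser_liouville`,
# stub K1b — THE KKT INEQUALITY OF A CONSTANT-SPEED EXTENDED EXTREMISER

`--supports stmt-NavierStokesRegularity-21883` (helper).  Author: prover seat `ns-el-k1b` (g2).

`ext_firstVariation_le_of_sup_inner`: for a constant-speed extended extremiser `v` (`‖v‖ ≡ M > 0`) and every smooth,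
compactly supported, divergence-free test field `φ` with `⟪v x, φ x⟫ ≤ s` for all `x`:
`S·J₁(φ) ≤ κ⋆² M² ((s/M²)·Z·W + W·a₁(φ) + Z·c₁(φ))`, i.e. the first-variation functional
`ℓ(φ) = S·J₁(φ) − κ⋆²M²(W a₁(φ) + Z c₁(φ))` satisfies **`ℓ(φ) ≤ κ⋆² Z W · sup ⟪v, φ⟫`** (the global-plateau KKT condition;
by Riesz it says `ℓ = ⟪v, ·⟫ μ` for a finite measure `μ ≥ 0` — not formalised here).  Proof: `‖v + εφ‖² = M² + 2ε⟪v,φ⟫ +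
ε²‖φ‖²` gives the one-sided norm bound with slope `(s + η)/M²` for every `η > 0`
(`norm_add_smul_le_of_inner_le`), then `ext_firstVariation_le_of_oneSided_normBound` and `η → 0`.

WHAT THIS IS NOT: a necessary condition on hypothetical constant-speed extremisers; nothing here proves NS regularity.
[folklore]
-/

noncomputable section

open Set Filter Topology MeasureTheory Metric Function
open scoped ENNReal NNReal Topology InnerProductSpace RealInnerProductSpace ContDiff
open Literature.Analysis.FluidPDE Literature.Analysis

namespace Summit.NavierStokesRegularity.NavierStokesRegularity.Theorems

-- the problem directory repeats the summit name (`NavierStokesRegularity/NavierStokesRegularity`)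
set_option linter.dupNamespace false

namespace ExtremiserLiouville

open DepletionLadder.KStar

variable {v φ : EuclideanSpace ℝ (Fin 3) → EuclideanSpace ℝ (Fin 3)}

/-- **KKT inequality of a constant-speed extended extremiser**: `ℓ(φ) ≤ κ⋆² Z W · s` whenever `⟪v, φ⟫ ≤ s` pointwise.
[folklore] -/
theorem ext_firstVariation_le_of_sup_inner
    (hv : ContDiff ℝ ∞ v) (hdiv : VectorCalculus.IsDivFree v) {M B : ℝ} (hMpos : 0 < M)
    (hM : ∀ x, ‖v x‖ = M) (hB : ∀ x, ‖fderiv ℝ v x‖ ≤ B)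
    (h1 : ∫⁻ x, ‖iteratedFDeriv ℝ 1 v x‖ₑ ^ 2 < ⊤) (h2 : ∫⁻ x, ‖iteratedFDeriv ℝ 2 v x‖ₑ ^ 2 < ⊤)
    (hatt : |∫ x, ⟪curl v x, fderiv ℝ v x (curl v x)⟫| = (sInf {κ : ℝ | (∀ (v : EuclideanSpace ℝ (Fin 3) → EuclideanSpace ℝ (Fin 3)) (M B : ℝ), ContDiff ℝ (⊤ : ℕ∞) v → Literature.Analysis.FluidPDE.VectorCalculus.IsDivFree v → (∀ x, ‖v x‖ ≤ M) → (∀ x, ‖fderiv ℝ v x‖ ≤ B) → (∫⁻ x, ‖iteratedFDeriv ℝ 0 v x‖ₑ ^ 2 < ⊤) → (∫⁻ x, ‖iteratedFDeriv ℝ 1 v x‖ₑ ^ 2 < ⊤) → (∫⁻ x, ‖iteratedFDeriv ℝ 2 v x‖ₑ ^ 2 < ⊤) → |∫ x, ⟪Literature.Analysis.FluidPDE.curl v x, fderiv ℝ v x (Literature.Analysis.FluidPDE.curl v x)⟫_ℝ| ≤ κ * M * Real.sqrt (∫ x, ‖Literature.Analysis.FluidPDE.curl v x‖ ^ 2) *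 Real.sqrt (∫ x, Literature.Analysis.FluidPDE.frobeniusNormSq (fderiv ℝ (Literature.Analysis.FluidPDE.curl v) x)))}) * M * Real.sqrt (∫ x, ‖curl v x‖ ^ 2) * Real.sqrt (∫ x, frobeniusNormSq (fderiv ℝ (curl v) x)))
    (hφ : ContDiff ℝ ∞ φ) (hφc : HasCompactSupport φ) (hφdiv : VectorCalculus.IsDivFree φ)
    {s : ℝ} (hs : ∀ x, ⟪v x, φ x⟫ ≤ s) :
    (∫ x, ⟪curl v x, fderiv ℝ v x (curl v x)⟫) * (∫ x, (⟪curl φ x, fderiv ℝ v x (curl v x)⟫ + ⟪curl v x, fderiv ℝ φ x (curl v x)⟫ + ⟪curl v x, fderiv ℝ v x (curl φ x)⟫)) ≤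
      (sInf {κ : ℝ | (∀ (v : EuclideanSpace ℝ (Fin 3) → EuclideanSpace ℝ (Fin 3)) (M B : ℝ), ContDiff ℝ (⊤ : ℕ∞) v → Literature.Analysis.FluidPDE.VectorCalculus.IsDivFree v → (∀ x, ‖v x‖ ≤ M) → (∀ x, ‖fderiv ℝ v x‖ ≤ B) → (∫⁻ x, ‖iteratedFDeriv ℝ 0 v x‖ₑ ^ 2 < ⊤) → (∫⁻ x, ‖iteratedFDeriv ℝ 1 v x‖ₑ ^ 2 < ⊤) → (∫⁻ x, ‖iteratedFDeriv ℝ 2 v x‖ₑ ^ 2 < ⊤) → |∫ x, ⟪Literature.Analysis.FluidPDE.curl v x, fderiv ℝ v x (Literature.Analysis.FluidPDE.curl v x)⟫_ℝ| ≤ κ * M * Real.sqrt (∫ x, ‖Literature.Analysis.FluidPDE.curl v x‖ ^ 2) * Real.sqrt (∫ x, Literature.Analysis.FluidPDE.frobeniusNormSq (fderiv ℝ (Literature.Analysis.FluidPDE.curl v) x)))}) ^ 2 * M ^ 2 * (s / M ^ 2 * (∫ x, ‖curl v x‖ ^ 2) * (∫ x, frobeniusNormSq (fderiv ℝ (curl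 v) x)) + (∫ x, frobeniusNormSq (fderiv ℝ (curl v) x)) * (∫ x, ⟪curl v x, curl φ x⟫) + (∫ x, ‖curl v x‖ ^ 2) * (∫ x, ∑ i, ⟪fderiv ℝ (curl v) x (EuclideanSpace.basisFun (Fin 3) ℝ i), fderiv ℝ (curl φ) x (EuclideanSpace.basisFun (Fin 3) ℝ i)⟫)) := by
  set K : ℝ := (sInf {κ : ℝ | (∀ (v : EuclideanSpace ℝ (Fin 3) → EuclideanSpace ℝ (Fin 3)) (M B : ℝ), ContDiff ℝ (⊤ : ℕ∞) v → Literature.Analysis.FluidPDE.VectorCalculus.IsDivFree v → (∀ x, ‖v x‖ ≤ M) → (∀ x, ‖fderiv ℝ v x‖ ≤ B) → (∫⁻ x, ‖iteratedFDeriv ℝ 0 v x‖ₑ ^ 2 < ⊤) → (∫⁻ x, ‖iteratedFDeriv ℝ 1 v x‖ₑ ^ 2 < ⊤) → (∫⁻ x, ‖iteratedFDeriv ℝ 2 v x‖ₑ ^ 2 < ⊤) → |∫ x, ⟪Literature.Analysis.FluidPDE.curl v x, fderiv ℝ v x (Literature.Analysis.FluidPDE.curl v x)⟫_ℝ| ≤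 κ * M * Real.sqrt (∫ x, ‖Literature.Analysis.FluidPDE.curl v x‖ ^ 2) * Real.sqrt (∫ x, Literature.Analysis.FluidPDE.frobeniusNormSq (fderiv ℝ (Literature.Analysis.FluidPDE.curl v) x)))}) with hK
  have hZ0 : 0 ≤ ∫ x, ‖curl v x‖ ^ 2 := integral_nonneg fun x => sq_nonneg _
  have hW0 : 0 ≤ ∫ x, frobeniusNormSq (fderiv ℝ (curl v) x) := integral_nonneg fun x => frobeniusNormSq_nonneg _
  obtain ⟨P, hP⟩ := hφ.continuous.bounded_above_of_compact_support hφc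
  -- for every `η > 0` the one-sided bound holds with slope `(s + η)/M²`
  have key : ∀ η : ℝ, 0 < η →
      (∫ x, ⟪curl v x, fderiv ℝ v x (curl v x)⟫) * (∫ x, (⟪curl φ x, fderiv ℝ v x (curl v x)⟫ + ⟪curl v x, fderiv ℝ φ x (curl v x)⟫ + ⟪curl v x, fderiv ℝ v x (curl φ x)⟫)) ≤
      K ^ 2 * M ^ 2 * ((s + η) / M ^ 2 * (∫ x, ‖curl v x‖ ^ 2) * (∫ x, frobeniusNormSq (fderiv ℝ (curl v) x)) + (∫ x, frobeniusNormSq (fderiv ℝ (curl v) x)) * (∫ x, ⟪curl v x, curl φ x⟫) + (∫ x, ‖curl v x‖ ^ 2) * (∫ x, ∑ i, ⟪fderiv ℝ (curl v) x (EuclideanSpace.basisFun (Fin 3) ℝ i), fderiv ℝ (curl φ) x (EuclideanSpace.basisFun (Fin 3) ℝ i)⟫)) := by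
    intro η hη
    obtain ⟨m, hm⟩ : ∃ m : ℝ, m = (s + η) / M ^ 2 := ⟨_, rfl⟩
    rw [← hm]
    have hε₀ : 0 < min (2 * η / (P ^ 2 + 1)) (1 / (|m| + 1)) := lt_min (by positivity) (by positivity)
    refine ext_firstVariation_le_of_oneSided_normBound hv hdiv hB h1 h2 hatt hφ hφc hφdiv hε₀ fun ε hε0 hε x => ?_
    have hε1 : ε < 2 * η / (P ^ 2 + 1) := lt_of_lt_of_le hε (min_le_left _ _)
    have hε2 : ε < 1 / (|m| + 1) := lt_of_lt_of_le hε (min_le_right _ _)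
    refine norm_add_smul_le_of_inner_le (hM x) hMpos.le (hs x) (hP x) hε0 ?_ ?_
    · have hms : m * M ^ 2 - s = η := by rw [hm]; field_simp; ring
      rw [hms]
      have hP2 : 0 < P ^ 2 + 1 := by positivity
      have h := (mul_le_mul_of_nonneg_right hε1.le (sq_nonneg P))
      refine h.trans ?_
      rw [div_mul_eq_mul_div, div_le_iff₀ hP2]
      nlinarith [sq_nonneg P]
    · have hmε : |m * ε| < 1 := by
        rw [abs_mul, abs_of_nonneg hε0]
        have h1' : |m| * ε ≤ |m| * (1 / (|m| + 1)) := mul_le_mul_of_nonneg_left hε2.le (abs_nonneg m)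
        have h2' : |m| * (1 / (|m| + 1)) < 1 := by
          rw [mul_one_div, div_lt_one (by positivity)]; linarith
        exact lt_of_le_of_lt h1' h2'
      have := neg_abs_le (m * ε)
      linarith
  -- let `η → 0`
  refine le_of_forall_pos_le_add fun ε hε => ?_
  have hKZW : 0 ≤ K ^ 2 * (∫ x, ‖curl v x‖ ^ 2) * (∫ x, frobeniusNormSq (fderiv ℝ (curl v) x)) := by positivity
  have h := key (ε / (K ^ 2 * (∫ x, ‖curl v x‖ ^ 2) * (∫ x, frobeniusNormSq (fderiv ℝ (curl v) x)) + 1)) (by positivity)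
  have hsplit : K ^ 2 * M ^ 2 * ((s + ε / (K ^ 2 * (∫ x, ‖curl v x‖ ^ 2) * (∫ x, frobeniusNormSq (fderiv ℝ (curl v) x)) + 1)) / M ^ 2 * (∫ x, ‖curl v x‖ ^ 2) * (∫ x, frobeniusNormSq (fderiv ℝ (curl v) x)) + (∫ x, frobeniusNormSq (fderiv ℝ (curl v) x)) * (∫ x, ⟪curl v x, curl φ x⟫) + (∫ x, ‖curl v x‖ ^ 2) * (∫ x, ∑ i, ⟪fderiv ℝ (curl v) x (EuclideanSpace.basisFun (Fin 3) ℝ i), fderiv ℝ (curl φ) x (EuclideanSpace.basisFun (Fin 3) ℝ i)⟫)) =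
      K ^ 2 * M ^ 2 * (s / M ^ 2 * (∫ x, ‖curl v x‖ ^ 2) * (∫ x, frobeniusNormSq (fderiv ℝ (curl v) x)) + (∫ x, frobeniusNormSq (fderiv ℝ (curl v) x)) * (∫ x, ⟪curl v x, curl φ x⟫) + (∫ x, ‖curl v x‖ ^ 2) * (∫ x, ∑ i, ⟪fderiv ℝ (curl v) x (EuclideanSpace.basisFun (Fin 3) ℝ i), fderiv ℝ (curl φ) x (EuclideanSpace.basisFun (Fin 3) ℝ i)⟫)) +
      K ^ 2 * (∫ x, ‖curl v x‖ ^ 2) * (∫ x, frobeniusNormSq (fderiv ℝ (curl v) x)) * (ε / (K ^ 2 * (∫ x, ‖curl v x‖ ^ 2) * (∫ x, frobeniusNormSq (fderiv ℝ (curl v) x)) + 1)) := by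
    field_simp
    ring
  rw [hsplit] at h
  have hlast : K ^ 2 * (∫ x, ‖curl v x‖ ^ 2) * (∫ x, frobeniusNormSq (fderiv ℝ (curl v) x)) *
      (ε / (K ^ 2 * (∫ x, ‖curl v x‖ ^ 2) * (∫ x, frobeniusNormSq (fderiv ℝ (curl v) x)) + 1)) ≤ ε := by
    rw [mul_div_assoc', div_le_iff₀ (by positivity)]
    nlinarith
  linarith

end ExtremiserLiouville

end Summit.NavierStokesRegularity.NavierStokesRegularity.Theorems

end
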